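import Literature.Probability.Percolation.OneArmArcCouplingAssembly
import HarnessLib

/-!
# Lawler–Schramm–Werner (2002), §2: (2.10) from the radial representation (2.7)–(2.8)

Topic `Literature/Probability/Percolation`; family `crit-perc`; theorems only (no definitions, no
named facts). Source: G. F. Lawler, O. Schramm, W. Werner, *One-arm exponent for critical 2D
percolation*, Electron. J. Probab. **7** (2002), paper no. 2 [LawlerSchrammWernerEJP2002], §2,
pp. 5–6.

After the coupling of `Q(θ)` with radial `SLE₆` (Thm. 2.1 and [13, Thm. 4.1]), LSW read the
conformal radius `𝔯(θ)` of the component of `0` in `𝕌 ∖ Q(θ)` through the radial Loewner chain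
(p. 5): with `T` the disconnection time, `ν = ±1` the side of disconnection (`Y_T = 2π`, resp.
`Y_T = 0`, for the boundary process `Y` of (2.9), (2.11)) and `r'` "the conformal radius about `0`
of `𝕌 ∖ Q_{W'}`", which "has the same distribution as `𝔯(2π)` and is independent from `⋃ₛ 𝓕ₛ`",

  (2.7) `𝔯(θ) = e^{-T}` if `ν = -1`,    (2.8) `𝔯(θ) = r' e^{-T}` if `ν = 1`,

whence (p. 5, last display)
`P[𝔯(θ) ≤ e^{-t} | 𝓕_T] = 1_{Y_T = 2π} P[r' ≤ e^{T - t} | 𝓕_T] + 1_{Y_T = 0, t ≤ T}` and (p. 6)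
"Taking expectation gives `h(θ, t) = E[h(Y_T^θ, t - T)]` (2.10), where we use the fact that
`h(θ, t) = 1` for `t ≤ 0`".

This file PROVES that last step — **(2.7) + (2.8) + independence ⟹ (2.10)** — in the tree's
vocabulary, where the radial Bessel process of SLE_κ lives on the space of Brownian paths
(`preWienerMeasure`; lifetime `T = sleLifetimeReal κ θ`, exit events `sleExitsTop κ θ = {Y_T = 2π}`,
`sleExitsBot κ θ = {Y_T = 0}`, `RadialBessel*.lean`) and (2.10) is the renewal extension
`renewalST κ 1_{≤0} w θ t = E^θ[1_{Y_T=0} 1_{t ≤ T} + 1_{Y_T=2π} w(t - T)]` (`RadialBesselRenewal`,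
`OneArmRenewal`):

* `measureReal_prod_radialEvent_eq_renewalST` — the law computation: for a probability measure `m`
  on `ℝ` (the law of `r'`), `κ > 4`, `θ ∈ (0, 2π)`,
  `(preWiener ⊗ m){(ω, r) | (Y_T = 0 ∧ s ≤ T) ∨ (Y_T = 2π ∧ r ≤ e^{-(s - T)})} = renewalST κ 1_{≤0} w θ s`
  with `w(u) = m(-∞, e^{-u}]` (Fubini; the dichotomy `P[Y_T = 0] + P[Y_T = 2π] = 1`);
* `measureReal_le_exp_eq_renewalST_of_radialCoupling` — **the random-variable form of LSW's step**:
  on any probability space, if `B` has law `preWienerMeasure`, `ρ` is independent of `B`, and `X`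
  satisfies `X = e^{-T(B)}` a.s. on `{Y_T = 0}` and `X = ρ e^{-T(B)}` a.s. on `{Y_T = 2π}`, then
  `P[X ≤ e^{-s}] = renewalST κ 1_{≤0} w_ρ θ s` for all `s`, `w_ρ(u) = P[ρ ≤ e^{-u}]`;
* `pairLimit_renewal_of_radialCoupling` — hence LSW's (2.10) at a joint law `μ` of `(K_θ, K_{2π})`
  (hypothesis `h210` of `OneArmArcCouplingAssembly.lean`) as soon as `𝔯(K_θ)` admits such a radial
  representation with `ρ ∼ 𝔯(K_{2π})`;
* `oneArm_exponent_of_pairLimit_radialCoupling`,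
  `LawlerSchrammWerner2002_hittingPDE_of_pairLimit_radialCoupling` — **the three LSW facts**
  (`LawlerSchrammWerner2002_hittingPDE`, `LawlerSchrammWerner2002_scalingLimitExponent` = Thm. 1.2,
  `oneArm_exponent` = Thm. 1.1) **follow from the existence, at every joint subsequential limit of
  the pair laws `lswPairLaw (R_k) θ`, of LSW's radial representation (2.7)–(2.8) of `𝔯(K_θ)`** with an
  independent factor distributed as `𝔯(K_{2π})` (`oneArm_exponent_of_pairLimit_renewal`).

What this leaves of LSW §2 is exactly the construction of that representation: Thm. 2.1
(Smirnov: the outer boundary of `Q(θ)` is `A_θ` followed by chordal `SLE₆`, the components of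
winding `-1` filled by independent conformal copies of `Q(2π)`), [13, Thm. 4.1] (chordal = radial
`SLE₆` up to the disconnection time) and the radial Loewner reading (2.5)–(2.6), (2.9) (`g_T'(0) = e^T`,
`Y_t → 2π` or `0` by harmonic measure) — resting on the tree's unproved named facts
`convergesInLawToSLE_six_triInterface` (crit-perc.S04) and `exists_isCNLFamily_tendsto` (S05).

## References

* G. F. Lawler, O. Schramm, W. Werner, *One-arm exponent for critical 2D percolation*, Electron.
  J. Probab. 7 (2002), no. 2, §2: Thm. 2.1 (p. 3), (2.5)–(2.9) and the display following (2.9)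
  (p. 5), (2.10) (p. 6). [LawlerSchrammWernerEJP2002]
* G. F. Lawler, O. Schramm, W. Werner, *Values of Brownian intersection exponents I: Half-plane
  exponents*, Acta Math. 187 (2001) 237–273, Thm. 4.1 (LSW's reference [13]).

## Mathlib / tree

Mathlib: `ProbabilityTheory.indepFun_iff_map_prod_eq_prod_map_map` (independence as a product
law), `MeasureTheory.Measure.prod_apply`, `MeasureTheory.measureReal_prod_prod`,
`MeasureTheory.ofReal_integral_eq_lintegral_ofReal`, `MeasureTheory.ae_of_ae_map`,
`MeasureTheory.map_measureReal_apply`, `Filter.eventuallyEq_set`. Tree: `sleLifetimeReal`,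
`sleExitsTop`, `sleExitsBot`, `disjoint_sleExitsTop_sleExitsBot`, `ae_mem_sleExitsTop_or_sleExitsBot`
(`RadialBesselLifetime`, `RadialBesselHitting`), `topST`, `botST`, `renewalST`, `renewalST_of_mem`
(`RadialBesselRenewal`), `bottomDatum` (`OneArmRenewal`), `lswPairLaw`,
`oneArm_exponent_of_pairLimit_renewal` (`OneArmArcHulls`, `OneArmArcCouplingAssembly`).
-/

noncomputable section

open MeasureTheory ProbabilityTheory Filter Topology Set TopologicalSpace Complex
open scoped NNReal ENNReal
open Literature.Probability.Process (preWienerMeasure)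
open Literature.Analysis.Complex (conformalRadius)
open Literature.Probability.RandomPlanarGeometry Literature.Probability.RandomPlanarGeometry.RadialLoewner

namespace Literature.Probability.Percolation

variable {κ : ℝ≥0} {θ : ℝ}

/-! ### The law computation on (Brownian path, fill radius) pairs -/

/-- `E^θ[1_{Y_T = 0} 1_{≤0}(s - T)] = P^θ[Y_T = 0, s ≤ T]`: the bottom half of (2.10) with the datum
`h(0, ·) = 1_{· ≤ 0}` is the probability of a bottom exit after time `s` ((2.7): `𝔯(θ) = e^{-T} ≤ e^{-s}`
iff `s ≤ T`). [cite: LawlerSchrammWernerEJP2002, §2 (2.7), (2.10)] -/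
theorem botST_bottomDatum_eq_measureReal (κ : ℝ≥0) (θ s : ℝ) :
    botST κ bottomDatum θ s =
      preWienerMeasure.real (sleExitsBot κ θ ∩ {ω | s ≤ sleLifetimeReal κ θ ω}) := by
  have hS : MeasurableSet (sleExitsBot κ θ ∩ {ω | s ≤ sleLifetimeReal κ θ ω}) :=
    (measurableSet_sleExitsBot κ θ).inter (measurableSet_le measurable_const (measurable_sleLifetimeReal κ θ))
  rw [← integral_indicator_one hS]
  unfold botST botExpect
  refine integral_congr_ae (Eventually.of_forall fun ω ↦ ?_)
  by_cases hω : ω ∈ sleExitsBot κ θ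
  · by_cases hs : s ≤ sleLifetimeReal κ θ ω
    · have hmem : ω ∈ sleExitsBot κ θ ∩ {ω | s ≤ sleLifetimeReal κ θ ω} := ⟨hω, hs⟩
      rw [indicator_of_mem hω, indicator_of_mem hmem, Pi.one_apply]
      show bottomDatum (s - sleLifetimeReal κ θ ω) = 1
      rw [bottomDatum, if_pos (by linarith)]
    · have hnmem : ω ∉ sleExitsBot κ θ ∩ {ω | s ≤ sleLifetimeReal κ θ ω} := fun h ↦ hs h.2
      rw [indicator_of_mem hω, indicator_of_notMem hnmem]
      show bottomDatum (s - sleLifetimeReal κ θ ω) = 0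
      rw [bottomDatum, if_neg (by linarith)]
  · rw [indicator_of_notMem hω, indicator_of_notMem (fun h ↦ hω h.1)]

/-- `E^θ[1_{Y_T = 2π} w(s - T)]` with `w(u) = m(-∞, e^{-u}]` is the `preWiener ⊗ m`-measure of
`{(ω, r) | Y_T = 2π ∧ r ≤ e^{-(s - T)}}` ((2.8): `𝔯(θ) = r' e^{-T} ≤ e^{-s}` iff `r' ≤ e^{T - s}`, `r'`
independent of the path; Fubini). [cite: LawlerSchrammWernerEJP2002, §2 (2.8), (2.10)] -/
theorem topST_eq_measureReal_prod (κ : ℝ≥0) (θ : ℝ) (m : Measure ℝ) [IsProbabilityMeasure m] (s : ℝ) :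
    topST κ (fun u ↦ m.real (Iic (Real.exp (-u)))) θ s =
      (preWienerMeasure.prod m).real {q : (ℝ≥0 → ℝ) × ℝ |
        q.1 ∈ sleExitsTop κ θ ∧ q.2 ≤ Real.exp (-(s - sleLifetimeReal κ θ q.1))} := by
  haveI := isProbabilityMeasure_preWienerMeasure'
  set T := sleLifetimeReal κ θ with hT
  set E₂ : Set ((ℝ≥0 → ℝ) × ℝ) := {q | q.1 ∈ sleExitsTop κ θ ∧ q.2 ≤ Real.exp (-(s - T q.1))} with hE₂
  have hmexp : Measurable fun q : (ℝ≥0 → ℝ) × ℝ ↦ Real.exp (-(s - T q.1)) :=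
    ((measurable_const.sub ((measurable_sleLifetimeReal κ θ).comp measurable_fst)).neg).exp
  have hE₂m : MeasurableSet E₂ :=
    (measurable_fst (measurableSet_sleExitsTop κ θ)).inter (measurableSet_le measurable_snd hmexp)
  -- the sections of `E₂`
  have hsec : ∀ ω, m (Prod.mk ω ⁻¹' E₂) =
      ENNReal.ofReal ((sleExitsTop κ θ).indicator (fun ω ↦ m.real (Iic (Real.exp (-(s - T ω))))) ω) := by
    intro ω
    by_cases hω : ω ∈ sleExitsTop κ θ
    · have : Prod.mk ω ⁻¹' E₂ = Iic (Real.exp (-(s - T ω))) := by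
        ext r; simp [hE₂, hω]
      rw [this, indicator_of_mem hω, ofReal_measureReal]
    · have : Prod.mk ω ⁻¹' E₂ = ∅ := by
        ext r; simp [hE₂, hω]
      rw [this, indicator_of_notMem hω, measure_empty, ENNReal.ofReal_zero]
  -- the integrand
  set g : (ℝ≥0 → ℝ) → ℝ := fun ω ↦ (sleExitsTop κ θ).indicator (fun ω ↦ m.real (Iic (Real.exp (-(s - T ω))))) ω
    with hg
  have hmono : Monotone fun y : ℝ ↦ m.real (Iic y) := fun y y' hyy' ↦
    measureReal_mono (Iic_subset_Iic.2 hyy')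
  have hgm : Measurable g :=
    (hmono.measurable.comp ((measurable_const.sub (measurable_sleLifetimeReal κ θ)).neg).exp).indicator
      (measurableSet_sleExitsTop κ θ)
  have hg0 : ∀ ω, 0 ≤ g ω := fun ω ↦ by
    by_cases hω : ω ∈ sleExitsTop κ θ
    · simp only [hg, indicator_of_mem hω]; exact measureReal_nonneg
    · simp only [hg, indicator_of_notMem hω]; exact le_rfl
  have hg1 : ∀ ω, g ω ≤ 1 := fun ω ↦ by
    by_cases hω : ω ∈ sleExitsTop κ θ
    · simp only [hg, indicator_of_mem hω]; exact measureReal_le_one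
    · simp only [hg, indicator_of_notMem hω]; exact zero_le_one
  have hgi : Integrable g preWienerMeasure :=
    Integrable.of_bound hgm.aestronglyMeasurable 1 (Eventually.of_forall fun ω ↦ by
      rw [Real.norm_eq_abs, abs_of_nonneg (hg0 ω)]; exact hg1 ω)
  have hprod : (preWienerMeasure.prod m) E₂ = ENNReal.ofReal (∫ ω, g ω ∂preWienerMeasure) := by
    rw [Measure.prod_apply hE₂m, ofReal_integral_eq_lintegral_ofReal hgi (Eventually.of_forall hg0)]
    exact lintegral_congr fun ω ↦ hsec ω
  have hreal : (preWienerMeasure.prod m).real E₂ = ∫ ω, g ω ∂preWienerMeasure := by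
    rw [measureReal_def, hprod, ENNReal.toReal_ofReal (integral_nonneg hg0)]
  rw [hreal]
  rfl

/-- **The law computation behind (2.10).** For a probability measure `m` on `ℝ` (the law of the
independent fill radius `r'`), `κ > 4` and `θ ∈ (0, 2π)`: the `preWiener ⊗ m`-probability that
`e^{-T} (r')^{1[Y_T = 2π]} ≤ e^{-s}` — spelled out on the two exit events as
`(Y_T = 0 ∧ s ≤ T) ∨ (Y_T = 2π ∧ r' ≤ e^{-(s - T)})` — is the renewal extension
`renewalST κ 1_{≤0} w θ s = E^θ[1_{Y_T=0} 1_{s ≤ T} + 1_{Y_T=2π} w(s - T)]` of `w(u) = m(-∞, e^{-u}]`.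
[cite: LawlerSchrammWernerEJP2002, §2 (2.7)–(2.8), display after (2.9) (p. 5), (2.10) (p. 6)] -/
theorem measureReal_prod_radialEvent_eq_renewalST (hθ : θ ∈ Ioo 0 (2 * Real.pi))
    (m : Measure ℝ) [IsProbabilityMeasure m] (s : ℝ) :
    (preWienerMeasure.prod m).real {q : (ℝ≥0 → ℝ) × ℝ |
        (q.1 ∈ sleExitsBot κ θ ∧ s ≤ sleLifetimeReal κ θ q.1) ∨
        (q.1 ∈ sleExitsTop κ θ ∧ q.2 ≤ Real.exp (-(s - sleLifetimeReal κ θ q.1)))} =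
      renewalST κ bottomDatum (fun u ↦ m.real (Iic (Real.exp (-u)))) θ s := by
  haveI := isProbabilityMeasure_preWienerMeasure'
  set T := sleLifetimeReal κ θ with hT
  set E₁ : Set ((ℝ≥0 → ℝ) × ℝ) := {q | q.1 ∈ sleExitsBot κ θ ∧ s ≤ T q.1} with hE₁
  set E₂ : Set ((ℝ≥0 → ℝ) × ℝ) := {q | q.1 ∈ sleExitsTop κ θ ∧ q.2 ≤ Real.exp (-(s - T q.1))} with hE₂
  have hmexp : Measurable fun q : (ℝ≥0 → ℝ) × ℝ ↦ Real.exp (-(s - T q.1)) :=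
    ((measurable_const.sub ((measurable_sleLifetimeReal κ θ).comp measurable_fst)).neg).exp
  have hE₂m : MeasurableSet E₂ :=
    (measurable_fst (measurableSet_sleExitsTop κ θ)).inter (measurableSet_le measurable_snd hmexp)
  have hunion : {q : (ℝ≥0 → ℝ) × ℝ | (q.1 ∈ sleExitsBot κ θ ∧ s ≤ T q.1) ∨
      (q.1 ∈ sleExitsTop κ θ ∧ q.2 ≤ Real.exp (-(s - T q.1)))} = E₁ ∪ E₂ := by
    ext q; simp [hE₁, hE₂]
  have hdisj : Disjoint E₁ E₂ := by
    refine Set.disjoint_left.2 fun q h1 h2 ↦ ?_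
    exact Set.disjoint_left.1 (disjoint_sleExitsTop_sleExitsBot κ θ) h2.1 h1.1
  have hE₁prod : E₁ = (sleExitsBot κ θ ∩ {ω | s ≤ T ω}) ×ˢ (univ : Set ℝ) := by
    ext q; simp [hE₁]
  rw [hunion, measureReal_union hdisj hE₂m, hE₁prod, measureReal_prod_prod, probReal_univ, mul_one,
    renewalST_of_mem κ _ _ hθ, botST_bottomDatum_eq_measureReal, topST_eq_measureReal_prod]

/-! ### The random-variable form: (2.7) + (2.8) + independence ⟹ (2.10) -/

/-- **LSW's "taking expectation gives (2.10)".** On a probability space let `B` be a path with law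
`preWienerMeasure` (driving the radial Bessel process of SLE_κ from `θ ∈ (0, 2π)`, `κ > 4`, with
lifetime `T(B)` and exit events `{Y_T = 2π}`, `{Y_T = 0}`), let `ρ` be a real random variable
**independent of `B`** ("`r'` … is independent from `⋃ₛ 𝓕ₛ`"), and let `X` satisfy
**(2.7) `X = e^{-T(B)}` a.s. on `{Y_T = 0}`** and **(2.8) `X = ρ e^{-T(B)}` a.s. on `{Y_T = 2π}`**. Then
for every `s`,

  `P[X ≤ e^{-s}] = renewalST κ 1_{≤0} w θ s = E^θ[1_{Y_T = 0} 1_{s ≤ T} + 1_{Y_T = 2π} w(s - T)]`,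
  `w(u) = P[ρ ≤ e^{-u}]`

— (2.10) `h(θ, t) = E[h(Y_T^θ, t - T)]` with `h(2π, ·) = w`, `h(0, ·) = h(·, t ≤ 0) = 1_{≤ 0}`-datum.
[cite: LawlerSchrammWernerEJP2002, §2 (2.7)–(2.8), display after (2.9) (p. 5), (2.10) (p. 6)] -/
theorem measureReal_le_exp_eq_renewalST_of_radialCoupling {Ω' : Type*} [MeasurableSpace Ω']
    {P : Measure Ω'} [IsProbabilityMeasure P] (hκ : 4 < κ) (hθ : θ ∈ Ioo 0 (2 * Real.pi))
    {B : Ω' → (ℝ≥0 → ℝ)} {ρ X : Ω' → ℝ} (hB : Measurable B) (hρ : Measurable ρ)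
    (hlawB : P.map B = preWienerMeasure) (hind : IndepFun B ρ P)
    (hbot : ∀ᵐ x ∂P, B x ∈ sleExitsBot κ θ → X x = Real.exp (-sleLifetimeReal κ θ (B x)))
    (htop : ∀ᵐ x ∂P, B x ∈ sleExitsTop κ θ → X x = ρ x * Real.exp (-sleLifetimeReal κ θ (B x)))
    (s : ℝ) :
    P.real {x | X x ≤ Real.exp (-s)} =
      renewalST κ bottomDatum (fun u ↦ P.real {x | ρ x ≤ Real.exp (-u)}) θ s := by
  set T := sleLifetimeReal κ θ with hT
  set E : Set ((ℝ≥0 → ℝ) × ℝ) := {q | (q.1 ∈ sleExitsBot κ θ ∧ s ≤ T q.1) ∨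
      (q.1 ∈ sleExitsTop κ θ ∧ q.2 ≤ Real.exp (-(s - T q.1)))} with hE
  have hmexp : Measurable fun q : (ℝ≥0 → ℝ) × ℝ ↦ Real.exp (-(s - T q.1)) :=
    ((measurable_const.sub ((measurable_sleLifetimeReal κ θ).comp measurable_fst)).neg).exp
  have hEm : MeasurableSet E :=
    ((measurable_fst (measurableSet_sleExitsBot κ θ)).inter
      (measurableSet_le measurable_const ((measurable_sleLifetimeReal κ θ).comp measurable_fst))).union
      ((measurable_fst (measurableSet_sleExitsTop κ θ)).inter (measurableSet_le measurable_snd hmexp))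
  -- the dichotomy `Y_T ∈ {0, 2π}` a.s., transported to `P` through the law of `B`
  have hdich : ∀ᵐ x ∂P, B x ∈ sleExitsTop κ θ ∨ B x ∈ sleExitsBot κ θ := by
    have h := ae_mem_sleExitsTop_or_sleExitsBot hκ hθ
    rw [← hlawB] at h
    exact ae_of_ae_map hB.aemeasurable h
  -- `{X ≤ e^{-s}}` is a.s. the preimage of `E` under `(B, ρ)`: (2.7) and (2.8)
  have hae : {x | X x ≤ Real.exp (-s)} =ᵐ[P] (fun x ↦ (B x, ρ x)) ⁻¹' E := by
    refine Filter.eventuallyEq_set.2 ?_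
    filter_upwards [hdich, hbot, htop] with x hd hb ht
    simp only [mem_setOf_eq, mem_preimage, hE]
    rcases hd with hxtop | hxbot
    · have hnot : B x ∉ sleExitsBot κ θ := fun h ↦
        Set.disjoint_left.1 (disjoint_sleExitsTop_sleExitsBot κ θ) hxtop h
      rw [ht hxtop]
      constructor
      · intro h
        refine Or.inr ⟨hxtop, ?_⟩
        rwa [show -(s - T (B x)) = -s - -T (B x) by ring, Real.exp_sub, le_div_iff₀ (Real.exp_pos _)]
      · rintro (⟨h, -⟩ | ⟨-, h⟩)
        · exact absurd h hnot
        · rwa [show -(s - T (B x)) = -s - -T (B x) by ring, Real.exp_sub,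
            le_div_iff₀ (Real.exp_pos _)] at h
    · have hnot : B x ∉ sleExitsTop κ θ := fun h ↦
        Set.disjoint_left.1 (disjoint_sleExitsTop_sleExitsBot κ θ) h hxbot
      rw [hb hxbot, Real.exp_le_exp, neg_le_neg_iff]
      constructor
      · exact fun h ↦ Or.inl ⟨hxbot, h⟩
      · rintro (⟨-, h⟩ | ⟨h, -⟩)
        · exact h
        · exact absurd h hnot
  -- independence: the law of `(B, ρ)` is `preWiener ⊗ law(ρ)`
  have hprod : P.map (fun x ↦ (B x, ρ x)) = (P.map B).prod (P.map ρ) :=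
    (indepFun_iff_map_prod_eq_prod_map_map hB.aemeasurable hρ.aemeasurable).1 hind
  haveI : IsProbabilityMeasure (P.map ρ) := Measure.isProbabilityMeasure_map hρ.aemeasurable
  rw [measureReal_congr hae, ← map_measureReal_apply (hB.prodMk hρ) hEm, hprod, hlawB,
    measureReal_prod_radialEvent_eq_renewalST hθ (P.map ρ) s]
  congr 1
  funext u
  rw [map_measureReal_apply hρ measurableSet_Iic]
  rfl

/-! ### Consequences for the arc hulls of LSW -/

/-- **(2.10) at a joint law from a radial representation of `𝔯(K_θ)`.** Let `μ` be a probability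
law of pairs `(K_θ, K_{2π})` of compact sets and `θ ∈ (0, 2π)`. Suppose that on some probability
space there are a path `B` with law `preWienerMeasure`, a real random variable `ρ` independent of
`B` with `P[ρ ≤ e^{-s}] = μ{𝔯(K_{2π}) ≤ e^{-s}}` for all `s` ("`r'` has the same distribution as
`𝔯(2π)`"), and a real random variable `X` with `P[X ≤ e^{-s}] = μ{𝔯(K_θ) ≤ e^{-s}}` for all `s`
(the law of `𝔯(θ)`) such that (2.7) `X = e^{-T(B)}` a.s. on `{Y_T = 0}` and (2.8)
`X = ρ e^{-T(B)}` a.s. on `{Y_T = 2π}` for the radial Bessel process of `SLE₆` from `θ`. Then LSW's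
(2.10) holds at `μ`: `μ{𝔯(K_θ) ≤ e^{-s}} = renewalST 6 1_{≤0} w_μ θ s`, `w_μ(s) = μ{𝔯(K_{2π}) ≤ e^{-s}}`
— the hypothesis `h210` of `oneArm_exponent_of_pairLimit_renewal` at `μ`.
[cite: LawlerSchrammWernerEJP2002, §2 (2.7)–(2.10) (pp. 5–6)] -/
theorem pairLimit_renewal_of_radialCoupling {θ : ℝ} (hθ : θ ∈ Ioo 0 (2 * Real.pi))
    (μ : ProbabilityMeasure (NonemptyCompacts ℂ × NonemptyCompacts ℂ))
    {Ω' : Type*} [MeasurableSpace Ω'] {P : Measure Ω'} [IsProbabilityMeasure P]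
    {B : Ω' → (ℝ≥0 → ℝ)} {ρ X : Ω' → ℝ} (hB : Measurable B) (hρ : Measurable ρ)
    (hlawB : P.map B = preWienerMeasure) (hind : IndepFun B ρ P)
    (hρlaw : ∀ s : ℝ, P.real {x | ρ x ≤ Real.exp (-s)} =
      (μ : Measure (NonemptyCompacts ℂ × NonemptyCompacts ℂ)).real
        {p | conformalRadius ((p.2 : NonemptyCompacts ℂ) : Set ℂ) ≤ Real.exp (-s)})
    (hXlaw : ∀ s : ℝ, P.real {x | X x ≤ Real.exp (-s)} =
      (μ : Measure (NonemptyCompacts ℂ × NonemptyCompacts ℂ)).real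
        {p | conformalRadius ((p.1 : NonemptyCompacts ℂ) : Set ℂ) ≤ Real.exp (-s)})
    (hbot : ∀ᵐ x ∂P, B x ∈ sleExitsBot 6 θ → X x = Real.exp (-sleLifetimeReal 6 θ (B x)))
    (htop : ∀ᵐ x ∂P, B x ∈ sleExitsTop 6 θ → X x = ρ x * Real.exp (-sleLifetimeReal 6 θ (B x)))
    (s : ℝ) :
    (μ : Measure (NonemptyCompacts ℂ × NonemptyCompacts ℂ)).real
        {p | conformalRadius ((p.1 : NonemptyCompacts ℂ) : Set ℂ) ≤ Real.exp (-s)} =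
      renewalST 6 bottomDatum (fun s ↦ (μ : Measure (NonemptyCompacts ℂ × NonemptyCompacts ℂ)).real
        {p | conformalRadius ((p.2 : NonemptyCompacts ℂ) : Set ℂ) ≤ Real.exp (-s)}) θ s := by
  rw [← hXlaw s, measureReal_le_exp_eq_renewalST_of_radialCoupling (κ := 6) (by norm_num) hθ hB hρ
    hlawB hind hbot htop s]
  congr 1
  funext u
  exact hρlaw u

/-- **The three LSW facts from the radial representation (2.7)–(2.8) at the joint subsequential
limits.** Suppose that for every `θ ∈ (0, 2π)`, every sequence of meshes `δ_k = 1/R_k → 0` and every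
weak limit `μ` of the joint laws `lswPairLaw (R_k) θ` of `(Q_{δ_k}(θ), Q_{δ_k}(2π))`, the conformal
radius of the first coordinate admits LSW's radial representation: on some probability space there
are a path `B` with law `preWienerMeasure` (driving radial `SLE₆` / its boundary process `Y` from
`θ`, lifetime `T`, exit side `Y_T ∈ {0, 2π}`), a random variable `ρ` independent of `B` and
distributed as `𝔯(K_{2π})` under `μ` ("an independent copy of `Q(2π)`", Thm. 2.1, read through its
conformal radius `r'`), and a random variable `X` distributed as `𝔯(K_θ)` under `μ` with
(2.7) `X = e^{-T}` on `{Y_T = 0}` and (2.8) `X = ρ e^{-T}` on `{Y_T = 2π}`. Then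
`LawlerSchrammWerner2002_hittingPDE`, LSW's Thm. 1.2 (`LawlerSchrammWerner2002_scalingLimitExponent`)
and Thm. 1.1 (`oneArm_exponent`) hold (`pairLimit_renewal_of_radialCoupling` feeds
`oneArm_exponent_of_pairLimit_renewal`). The hypothesis is the content of LSW's Thm. 2.1 with
[13, Thm. 4.1] and (2.5)–(2.9); it rests on the scaling-limit facts crit-perc.S04/S05 of the tree.
[cite: LawlerSchrammWernerEJP2002, Thm. 1.1, Thm. 1.2, §2: Thm. 2.1, (2.5)–(2.10), Lemma 2.2, Lemma 2.3] -/
theorem oneArm_exponent_of_pairLimit_radialCoupling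
    (hrad : ∀ (θ : ℝ) (R : ℕ → ℝ) (μ : ProbabilityMeasure (NonemptyCompacts ℂ × NonemptyCompacts ℂ)),
      θ ∈ Ioo 0 (2 * Real.pi) → Tendsto R atTop atTop → Tendsto (fun k ↦ lswPairLaw (R k) θ) atTop (𝓝 μ) →
      ∃ (Ω' : Type) (_ : MeasurableSpace Ω') (P : Measure Ω') (_ : IsProbabilityMeasure P)
        (B : Ω' → (ℝ≥0 → ℝ)) (ρ X : Ω' → ℝ),
        Measurable B ∧ Measurable ρ ∧ P.map B = preWienerMeasure ∧ IndepFun B ρ P ∧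
        (∀ s : ℝ, P.real {x | ρ x ≤ Real.exp (-s)} =
          (μ : Measure (NonemptyCompacts ℂ × NonemptyCompacts ℂ)).real
            {p | conformalRadius ((p.2 : NonemptyCompacts ℂ) : Set ℂ) ≤ Real.exp (-s)}) ∧
        (∀ s : ℝ, P.real {x | X x ≤ Real.exp (-s)} =
          (μ : Measure (NonemptyCompacts ℂ × NonemptyCompacts ℂ)).real
            {p | conformalRadius ((p.1 : NonemptyCompacts ℂ) : Set ℂ) ≤ Real.exp (-s)}) ∧
        (∀ᵐ x ∂P, B x ∈ sleExitsBot 6 θ → X x = Real.exp (-sleLifetimeReal 6 θ (B x))) ∧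
        (∀ᵐ x ∂P, B x ∈ sleExitsTop 6 θ → X x = ρ x * Real.exp (-sleLifetimeReal 6 θ (B x)))) :
    LawlerSchrammWerner2002_hittingPDE ∧ LawlerSchrammWerner2002_scalingLimitExponent ∧ oneArm_exponent := by
  refine oneArm_exponent_of_pairLimit_renewal fun θ R μ hθ hR hμ s ↦ ?_
  obtain ⟨Ω', _, P, _, B, ρ, X, hB, hρ, hlawB, hind, hρlaw, hXlaw, hbot, htop⟩ := hrad θ R μ hθ hR hμ
  exact pairLimit_renewal_of_radialCoupling hθ μ hB hρ hlawB hind hρlaw hXlaw hbot htop s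

/-- **`LawlerSchrammWerner2002_hittingPDE` from the radial representation (2.7)–(2.8) at the joint
subsequential limits** (`oneArm_exponent_of_pairLimit_radialCoupling`, first component).
[cite: LawlerSchrammWernerEJP2002, §2: Thm. 2.1, (2.5)–(2.10), Lemma 2.2, Lemma 2.3] -/
theorem LawlerSchrammWerner2002_hittingPDE_of_pairLimit_radialCoupling
    (hrad : ∀ (θ : ℝ) (R : ℕ → ℝ) (μ : ProbabilityMeasure (NonemptyCompacts ℂ × NonemptyCompacts ℂ)),
      θ ∈ Ioo 0 (2 * Real.pi) → Tendsto R atTop atTop → Tendsto (fun k ↦ lswPairLaw (R k) θ) atTop (𝓝 μ) →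
      ∃ (Ω' : Type) (_ : MeasurableSpace Ω') (P : Measure Ω') (_ : IsProbabilityMeasure P)
        (B : Ω' → (ℝ≥0 → ℝ)) (ρ X : Ω' → ℝ),
        Measurable B ∧ Measurable ρ ∧ P.map B = preWienerMeasure ∧ IndepFun B ρ P ∧
        (∀ s : ℝ, P.real {x | ρ x ≤ Real.exp (-s)} =
          (μ : Measure (NonemptyCompacts ℂ × NonemptyCompacts ℂ)).real
            {p | conformalRadius ((p.2 : NonemptyCompacts ℂ) : Set ℂ) ≤ Real.exp (-s)}) ∧
        (∀ s : ℝ, P.real {x | X x ≤ Real.exp (-s)} =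
          (μ : Measure (NonemptyCompacts ℂ × NonemptyCompacts ℂ)).real
            {p | conformalRadius ((p.1 : NonemptyCompacts ℂ) : Set ℂ) ≤ Real.exp (-s)}) ∧
        (∀ᵐ x ∂P, B x ∈ sleExitsBot 6 θ → X x = Real.exp (-sleLifetimeReal 6 θ (B x))) ∧
        (∀ᵐ x ∂P, B x ∈ sleExitsTop 6 θ → X x = ρ x * Real.exp (-sleLifetimeReal 6 θ (B x)))) :
    LawlerSchrammWerner2002_hittingPDE :=
  (oneArm_exponent_of_pairLimit_radialCoupling hrad).1

end Literature.Probability.Percolation
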